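import Literature.NumberTheory.LFunctions.BettinChandee2018TrilinearKloostermanFractions
import Literature.NumberTheory.Sieve.UnbalancedConvolutionsLevel
import HarnessLib

/-!
# Trilinear forms with Kloosterman fractions and a fixed factor in the denominator
# (Wright 2026, arXiv:2604.25177, §2: Theorem 2.1 and its dispersion consequences)

Topic `NumberTheory/LFunctions` (next to `BettinChandee2018TrilinearKloostermanFractions.lean` and the
`KloostermanFractions*.lean` / `TrilinearKloostermanFractions*.lean` proof project).  Source: T. Wright,
*Trilinear Kloosterman fractions I: partially fixed moduli and unbalanced convolutions*, arXiv:2604.25177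
(v1, April 2026; 10 pp.; PREPRINT, not refereed at the time of typing) [Wright2026TrilinearKloostermanI],
§2 "New ideas", **Theorem 2.1** (held text `paper:arxiv-2604.25177`, chunk p0004:L38–L45; proof = §3,
chunk p0006), vendored AS PRINTED as a named fact (statement only, not proved here; status for the
landau-siegel E(d) registry: «theorem-in-print (preprint 2026)»):

  "Let `M ≪ N²` and `R ≪ M^A` for some large `A`. Then
  `𝓑(M,N,A;R) ≪ M^ε ‖α‖ ‖ν‖ ‖β‖ (AMN)^{1/2} R^{1/4} (1 + |ϑ|A/(MN))^{1/4}`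
  `  × ( N^{−1/8} + R^{1/8}N^{1/8}/M^{1/4} + M^{1/10}/(R^{3/20}A^{1/20}N^{3/20}) + N^{3/20}/(A^{3/20}M^{1/5}) + N^{3/8}/M^{1/2} )`.
  When `R = 1`, this is (7.2) of [BC]."

where (p0004:L30–L36)
`𝓑(M,N,A;R) := ∑∑∑_{a ∈ 𝒜, m ∈ ℳ, n ∈ 𝒩, (m, nR) = 1} α_m β_n ν_a e(ϑ a m̄/(nR))`, `m̄ m ≡ 1 (mod nR)`, `ϑ` a
non-zero integer, `R ≥ 1` an integer (the FIXED factor of the denominator — "partially fixed moduli"),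
`α, β, ν` arbitrary complex coefficients on dyadic boxes, `‖·‖` the `ℓ²` norm.  It is Bettin–Chandee's
trilinear form `𝓑(M,N,A)` [BettinChandee2018, Theorem 1] (tree: `BettinChandee2018_trilinearKloostermanFractions`)
with the denominator `n` replaced by `nR`; the proof (§3) runs Bettin–Chandee's complementary-divisor
bound (5.2) for `𝒞_b` (tree: the `KloostermanFractionsCb` / `TrilinearKloostermanFractionsFromCb` files)
with the built-in divisor `R`, then Cauchy–Schwarz.

## What is typed

* `fixedFactorTrilinearSum R ϑ M N A α β ν` — the object `𝓑(M,N,A;R)` (finite triple sum), rendered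
  EXACTLY like the sum inside `BettinChandee2018_trilinearKloostermanFractions`: boxes `(M,2M]`, `(N,2N]`,
  `(A,2A]` carried as support hypotheses on `α β ν : ℕ → ℂ`, sums over `1 ≤ m ≤ ⌊2M⌋` etc.,
  `m̄ = ((m : ZMod (nR))⁻¹).val`, `e(t) = exp(2πit)` (the print's boxes `[M/2, M]` differ by the factor `2`,
  absorbed in the implied constant, as in the Bettin–Chandee file);
* `fixedFactorTrilinearSum_one` — PROVED: at `R = 1` the object is Bettin–Chandee's `𝓑(M,N,A)` summand
  for summand ("When `R = 1`, this is (7.2) of [BC]" — the objects agree; the BOUNDS (7.2)/Thm 2.1 differ);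
* `Wright2026_trilinearKloostermanFractions_fixedFactor` — **Theorem 2.1** as a named fact;
* `Wright2026_corollary22`, `Wright2026_theorem23`, `Wright2026_corollary24` — **Corollary 2.2,
  Theorem 2.3, Corollary 2.4** (the dispersion consequences, over the tree's Fouvry–Radziwiłł
  vocabulary; see the section below) as named facts, and the PROVED exponent bookkeeping
  `Wright2026_corollary22_exponents`.

Rendering of the two `≪`-hypotheses: "`M ≪ N²` and `R ≪ M^A` for some large `A`" become an explicit
constant `C ≥ 1` on which the implied constant `K` may depend: `M ≤ C·N²` and `R ≤ (2M)^C`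
(`∀ C ≥ 1, ∀ ε > 0, ∃ K, …`).  Sizes `M, N, A ≥ 1/2` (tree convention, so that a variable may take the
value `1`).

PRINT CAVEATS (recorded, not repaired): (i) the `ε`-power is printed `M^ε`; it is typed `(AMN)^ε`, which
is WEAKER than print (implied by it, since `A, N ≥ 1/2`) and matches the `ε`-powers of the Bettin–Chandee
inputs (5.2)/(7.2) the proof quotes (those carry all of `b, M, N, A`); in every application of the paper
and in the regime of interest below `A ≤ (MN)^{O(1)}`, where the two agree up to `ε ↦ O(ε)`.  (ii) The last
display of the proof (§3, p0006 end) has `A^{3/10}` in the denominator of the third term where the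
statement prints `A^{1/20}`; the statement (the weaker exponent for `A ≥ 1`) is typed.  (iii) The exponent
of `(1 + |ϑ|A/(MN))` is `1/4` (Bettin–Chandee's Theorem 1 has `1/2`; here it enters through `𝒞^{1/2}`).

## The rest of §2: the dispersion consequences (Corollary 2.2, Theorem 2.3, Corollary 2.4)

§2 also prints three improvements of Fouvry–Radziwiłł, ASENS 55 (2022) [FouvryRadziwill2022] — of its
Cor 1.1, Thm 1.1 and Cor 1.5 respectively — obtained by feeding Theorem 2.1 into the dispersion
argument (§4: only the term `W^{Err1}` of [FR, (48)] is re-bounded; §5).  They are typed AS PRINTED as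
named facts over the Fouvry–Radziwiłł vocabulary of the tree
(`Literature.NumberTheory.Sieve.FouvryRadziwill2022.*`, file `Sieve/UnbalancedConvolutionsLevel.lean`:
`IsDivisorBounded`, `IsSiegelWalfiszWith`, `l2Norm`, `Delta` (1.5), `calEstar` (1.6), `bilinEWindow`,
`BFI.dyadic`), each rendered by the SAME quantifier shape as the Fouvry–Radziwiłł statement it
improves (`corollary11` / `theorem11` / `corollary15`), with only the printed exponents changed:

* `Wright2026_corollary22` — **Corollary 2.2** (p0004:L47–L75): level of distribution for unbalanced
  convolutions `α ∗ β`, `β` Siegel–Walfisz, under (i) `exp((log X)^ε) ≤ N ≤ Q^{−33/28}X^{17/28−ε}`,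
  `1 ≤ |a| ≤ X/12`; or (ii) `exp((log X)^ε) ≤ N ≤ X^{7/90−ε}`, `Q ≤ X^{45/89−ε}`, `1 ≤ |a| ≤ X/12`; or
  (iii) `exp((log X)^ε) ≤ N ≤ X^{101/630−ε}`, `Q ≤ X^{45/89−ε}`, `1 ≤ |a| ≤ (X/4)^{ε/1000}`
  (Fouvry–Radziwiłł: `Q^{−11/12}X^{17/36−ε}`, `X^{53/105−ε}`); ibid. "if `Q = X^{1/2+ε}` then (i) …
  gives `N ≤ X^{1/56−ε'}`" (vs `X^{1/72−ε'}`).  PRINT NOTE: the corollary writes `X` for the `x` of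
  [FR, Cor 1.1] (`MN/2 ≤ X ≤ 4MN`, window `X < mn ≤ 2X`) and once `x (log X)^{−A}`; typed with one
  variable `x` as in `FouvryRadziwill2022.corollary11`.
* `Wright2026_theorem23` — **Theorem 2.3** (p0005:L12–L28): the dispersion estimate with last bracket
  `D^C X^ε (Q^{15/8}N^{11/4} + M^{3/20}Q^{33/20}N^{51/20})` (Fouvry–Radziwiłł: `N^{23/8}Q^{15/8} +
  M^{3/20}N^{59/20}Q^{33/20}`; "a savings of `N^{1/8}` in the first term and `N^{2/5}` in the second").
  PRINT NOTE: the hypotheses are printed as "Let `k, ε, α_m, β_n` be as in the previous corollary. Let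
  `k ≥ 1` … `M > Q(MN)^ε`, `M > N > D^{10}`" — i.e. those of [FR, Thm 1.1] PLUS (through "as in the
  previous corollary") the Siegel–Walfisz condition on `β`, which neither [FR, Thm 1.1] nor the §4 proof
  uses before its last sentence; the typed fact keeps it as a hypothesis (the statement as printed, hence
  the weaker one), with the implied constants allowed to depend on the Siegel–Walfisz data.
* `Wright2026_corollary24` — **Corollary 2.4** (p0005:L32–L60): sieve weights `∑_{d∣n, d≤z} λ_d` to moduli
  near `X` under (i) `z ≤ X^{45/89−ε}`, `X^{1−ε} > Q > X^{529/630+ε}`, `1 ≤ |a| ≤ X^{ε/10000}`; (ii)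
  `z ≤ X^{45/89−ε}`, `X^{1−ε} > Q > X^{83/90+ε}`, `1 ≤ |a| ≤ X^{1−3ε}`; (iii) `z ≤ X^{1/2+δ−ε}`,
  `X^{1−ε} > Q > X^{(55+66δ)/56+ε}`, `1 ≤ |a| ≤ X^{1−3ε}`, `0 < δ < 1/66` (Fouvry–Radziwiłł: `53/105`,
  `(71+66δ)/72`); "The proof of this corollary is essentially identical to that of Corollary 1.5 in [FR]
  … we omit this proof."

These three bear on level-of-distribution questions (Parity routes citing [FouvryRadziwill2022] /
arXiv:2604.25177), not on the landau-siegel (14.8) range, for which Theorem 2.1 is the relevant object.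

## Why here (landau-siegel programme, family B-ell; no claim beyond the typing)

The ELL-CENSUS of arXiv:2211.02515 §§14–17 names as first loss the bound (14.8) (tree:
`Zhang2022.Typed.Sec14.Eq148`, `lhs148`, `rhs1417`), whose core is the form
`∑_{p ∼ P} ∑_{l} β_p κ*(dl) e(−l p̄/(Dk)) Δ(l/(Dpk))` at moduli `Dk`, `k ≤ 2P₄`, with `D` FIXED: after
separating the weight `Δ(l/(Dpk))` this is `𝓑(M,N,A;R)` with the dictionary
`(a, m, n, R, ϑ) ↔ (l, p, k, D, −1)`, `M = P` (`α` supported on primes), `N` = the dyadic size of `k`,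
`R = D`, `A` = the length of `l` (`≍ P·Dk·t₀ℒ₂` in print, i.e. `A ≍ MNR` up to powers of `log D`).
Theorem 2.1 is the only printed Kloosterman-fraction bound with a fixed denominator factor; whether its
ranges (`M ≪ N²`, the `(1+|ϑ|A/(MN))^{1/4} ≍ R^{1/4}` loss at `A ≍ MNR`) reach any part of the (14.8)
range is a question for the family's EDLIST/DESIGN-MAP, not asserted here.

## References

* T. Wright, *Trilinear Kloosterman fractions I: partially fixed moduli and unbalanced convolutions*,
  arXiv:2604.25177 (2026), §2 Theorem 2.1, Corollary 2.2, Theorem 2.3, Corollary 2.4; §3.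
  [Wright2026TrilinearKloostermanI]
* S. Bettin, V. Chandee, *Trilinear forms with Kloosterman fractions*, Adv. Math. 328 (2018) 1234–1262
  (arXiv:1502.00769), Theorem 1, (5.2), (7.2). [BettinChandee2018]
* É. Fouvry, M. Radziwiłł, *Level of distribution of unbalanced convolutions*, Ann. Sci. ÉNS (4) 55
  (2022) 537–568 (arXiv:1811.08672), Thm 1.1, Cor 1.1, Cor 1.5. [FouvryRadziwill2022]
* W. Duke, J. Friedlander, H. Iwaniec, *Bilinear forms with Kloosterman fractions*, Invent. Math. 128
  (1997) 23–43. [DukeFriedlanderIwaniec1997]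

«The programme SEARCHES and TYPES; no claim about Landau–Siegel zeros, Theorems 1–2 of arXiv:2211.02515 or
a repaired Margin232 until a kernel theorem says so.»
-/

noncomputable section

open Finset Real

namespace Literature.NumberTheory.LFunctions

/-- **The trilinear form with Kloosterman fractions and a fixed factor `R` in the denominator**,
`𝓑(M,N,A;R) = ∑_{a} ∑_{m} ∑_{n, (m, nR) = 1} α_m β_n ν_a e(ϑ a m̄/(nR))` (Wright, arXiv:2604.25177, §2,
display before Theorem 2.1), as a finite sum over the boxes `1 ≤ a ≤ ⌊2A⌋`, `1 ≤ m ≤ ⌊2M⌋`,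
`1 ≤ n ≤ ⌊2N⌋` (the dyadic supports `(A,2A]`, `(M,2M]`, `(N,2N]` are hypotheses on `ν, α, β` in the
theorem), `m̄ = ((m : ZMod (nR))⁻¹).val`, `e(t) = exp(2πit)` — the rendering of
`BettinChandee2018_trilinearKloostermanFractions` with denominator `nR`.
[cite: Wright2026TrilinearKloostermanI, §2 (definition of 𝓑(M,N,A;R))] -/
def fixedFactorTrilinearSum (R : ℕ) (ϑ : ℤ) (M N A : ℝ) (α β ν : ℕ → ℂ) : ℂ :=
  ∑ a ∈ Icc 1 ⌊2 * A⌋₊, ∑ m ∈ Icc 1 ⌊2 * M⌋₊, ∑ n ∈ Icc 1 ⌊2 * N⌋₊,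
    if m.Coprime (n * R) then
      α m * β n * ν a * Complex.exp (2 * Real.pi * Complex.I *
        ((ϑ : ℂ) * (a : ℂ) * ((((m : ZMod (n * R))⁻¹).val : ℕ) : ℂ) / ((n : ℂ) * (R : ℂ))))
    else 0

/-- "When `R = 1`, this is [the object of] (7.2) of [BC]": at `R = 1` the fixed-factor form is
Bettin–Chandee's `𝓑(M,N,A) = ∑∑∑_{(m,n)=1} α_m β_n ν_a e(ϑ a m̄/n)`, term by term (the sum inside
`BettinChandee2018_trilinearKloostermanFractions`).
[cite: Wright2026TrilinearKloostermanI, §2 Theorem 2.1 (remark after the statement)] -/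
theorem fixedFactorTrilinearSum_one (ϑ : ℤ) (M N A : ℝ) (α β ν : ℕ → ℂ) :
    fixedFactorTrilinearSum 1 ϑ M N A α β ν =
      ∑ a ∈ Icc 1 ⌊2 * A⌋₊, ∑ m ∈ Icc 1 ⌊2 * M⌋₊, ∑ n ∈ Icc 1 ⌊2 * N⌋₊,
        if m.Coprime n then
          α m * β n * ν a * Complex.exp (2 * Real.pi * Complex.I *
            ((ϑ : ℂ) * (a : ℂ) * ((((m : ZMod n)⁻¹).val : ℕ) : ℂ) / (n : ℂ)))
        else 0 := by
  unfold fixedFactorTrilinearSum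
  refine Finset.sum_congr rfl fun a _ => Finset.sum_congr rfl fun m _ =>
    Finset.sum_congr rfl fun n _ => ?_
  rw [Nat.mul_one]
  simp only [Nat.cast_one, mul_one]

/-- **Wright 2026, Theorem 2.1 (trilinear forms with Kloosterman fractions, fixed factor `R` in the
denominator)**, as printed (arXiv:2604.25177 §2, p0004:L38–L45): "Let `M ≪ N²` and `R ≪ M^A` for some
large `A`. Then
`𝓑(M,N,A;R) ≪ M^ε ‖α‖‖ν‖‖β‖ (AMN)^{1/2} R^{1/4} (1 + |ϑ|A/(MN))^{1/4} (N^{−1/8} + R^{1/8}N^{1/8}M^{−1/4}`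
`+ M^{1/10}R^{−3/20}A^{−1/20}N^{−3/20} + N^{3/20}A^{−3/20}M^{−1/5} + N^{3/8}M^{−1/2})`."
Here `ϑ ≠ 0` is an integer, `R ≥ 1` an integer, `α, β, ν` arbitrary complex coefficients on the dyadic
boxes `(M,2M]`, `(N,2N]`, `(A,2A]` (`M, N, A ≥ 1/2`), `‖·‖` the `ℓ²` norm; the hypotheses "`M ≪ N²`,
`R ≪ M^A`" are rendered with an explicit `C ≥ 1` (`M ≤ C N²`, `R ≤ (2M)^C`) on which `K = K(C, ε)` may
depend; the printed `M^ε` is typed as the WEAKER `(AMN)^ε` (module docstring, PRINT CAVEATS (i)); the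
exponents `A^{−1/20}` (statement; the proof's last display has `A^{−3/10}`) and `1/4` on
`(1 + |ϑ|A/(MN))` are as printed.  Preprint (2026), named fact, not proved here.  At `R = 1` the OBJECT
is Bettin–Chandee's (`fixedFactorTrilinearSum_one`); the bound is then (7.2) of [BettinChandee2018].
[cite: Wright2026TrilinearKloostermanI, §2 Theorem 2.1] -/
def Wright2026_trilinearKloostermanFractions_fixedFactor : Prop :=
  ∀ C : ℝ, 1 ≤ C → ∀ ε : ℝ, 0 < ε → ∃ K : ℝ, 0 < K ∧
    ∀ (M N A : ℝ), 1 / 2 ≤ M → 1 / 2 ≤ N → 1 / 2 ≤ A → M ≤ C * N ^ 2 →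
    ∀ (R : ℕ), 0 < R → (R : ℝ) ≤ (2 * M) ^ C →
    ∀ (ϑ : ℤ), ϑ ≠ 0 → ∀ (α β ν : ℕ → ℂ),
      (∀ m : ℕ, α m ≠ 0 → M < m ∧ (m : ℝ) ≤ 2 * M) →
      (∀ n : ℕ, β n ≠ 0 → N < n ∧ (n : ℝ) ≤ 2 * N) →
      (∀ a : ℕ, ν a ≠ 0 → A < a ∧ (a : ℝ) ≤ 2 * A) →
      ‖fixedFactorTrilinearSum R ϑ M N A α β ν‖ ≤
        K * (A * M * N) ^ ε *
          Real.sqrt (∑ m ∈ Icc 1 ⌊2 * M⌋₊, ‖α m‖ ^ 2) *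
          Real.sqrt (∑ n ∈ Icc 1 ⌊2 * N⌋₊, ‖β n‖ ^ 2) *
          Real.sqrt (∑ a ∈ Icc 1 ⌊2 * A⌋₊, ‖ν a‖ ^ 2) *
          ((A * M * N) ^ (1 / 2 : ℝ) * (R : ℝ) ^ (1 / 4 : ℝ) *
            (1 + |(ϑ : ℝ)| * A / (M * N)) ^ (1 / 4 : ℝ)) *
          (N ^ (-(1 / 8 : ℝ)) +
            (R : ℝ) ^ (1 / 8 : ℝ) * N ^ (1 / 8 : ℝ) * M ^ (-(1 / 4 : ℝ)) +
            M ^ (1 / 10 : ℝ) * (R : ℝ) ^ (-(3 / 20 : ℝ)) * A ^ (-(1 / 20 : ℝ)) * N ^ (-(3 / 20 : ℝ)) +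
            N ^ (3 / 20 : ℝ) * A ^ (-(3 / 20 : ℝ)) * M ^ (-(1 / 5 : ℝ)) +
            N ^ (3 / 8 : ℝ) * M ^ (-(1 / 2 : ℝ)))

/-! ### §2, the dispersion consequences (over `Literature.NumberTheory.Sieve.FouvryRadziwill2022`) -/

section Dispersion

open Literature.NumberTheory.Sieve Literature.NumberTheory.Sieve.FouvryRadziwill2022

/-- **Wright 2026, Corollary 2.2** (arXiv:2604.25177 §2, p0004:L47–L75), as printed: "Let `k > 0` and
`ε > 0` be given. Let `α_m` and `β_n` be `k`-fold divisor-bounded sequences of complex numbers as in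
Corollary 1.1 [of Fouvry–Radziwiłł: `α = (α_m)_{M<m≤2M}`, `β = (β_n)_{N<n≤2N}`, `|α_m| ≤ τ_k(m)`,
`|β_n| ≤ τ_k(n)`] with `β_n` satisfying the Siegel–Walfisz condition. Then for every `A > 0`,
uniformly for `M, N ≥ 2` with `MN/2 ≤ X ≤ 4MN`, we have
`∑_{Q≤q≤2Q, (q,a)=1} | ∑∑_{X<mn≤2X, mn≡a (q)} α_m β_n − φ(q)⁻¹ ∑∑_{X<mn≤2X, (mn,q)=1} α_m β_n | ≪_A X (log X)^{−A}`,
provided that one of the following three conditions holds: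
(i) `exp((log X)^ε) ≤ N ≤ Q^{−33/28} X^{17/28−ε}` and `1 ≤ |a| ≤ X/12`;
(ii) `exp((log X)^ε) ≤ N ≤ X^{7/90−ε}`, `Q ≤ X^{45/89−ε}`, and `1 ≤ |a| ≤ X/12`;
(iii) `exp((log X)^ε) ≤ N ≤ X^{101/630−ε}`, `Q ≤ X^{45/89−ε}`, and `1 ≤ |a| ≤ (X/4)^{ε/1000}`."
(Improves `FouvryRadziwill2022.corollary11`: `Q^{−11/12}X^{17/36−ε}` ↦ `Q^{−33/28}X^{17/28−ε}`,
`X^{53/105−ε}` ↦ `X^{45/89−ε}`.)  Rendered by the same quantifier shape as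
`FouvryRadziwill2022.corollary11` (one variable `x` for the print's `X`/`x`; the implied constant may
depend on `k, ε, A` and on the Siegel–Walfisz data of `β`).  Preprint (2026), named fact, not proved here.
[cite: Wright2026TrilinearKloostermanI, §2 Corollary 2.2] -/
def Wright2026_corollary22 : Prop :=
  ∀ k : ℕ, 0 < k → ∀ ε : ℝ, 0 < ε → ∀ (ksw : ℕ) (Csw : ℝ → ℝ), ∀ A : ℝ, 0 < A → ∃ K : ℝ,
    ∀ M N x Q : ℝ, 2 ≤ M → 2 ≤ N → M * N / 2 ≤ x → x ≤ 4 * M * N →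
    ∀ α β : ℕ → ℂ, IsDivisorBounded k α → IsDivisorBounded k β →
      (∀ m : ℕ, α m ≠ 0 → M < m ∧ (m : ℝ) ≤ 2 * M) →
      (∀ n : ℕ, β n ≠ 0 → N < n ∧ (n : ℝ) ≤ 2 * N) →
      IsSiegelWalfiszWith ksw Csw β →
    ∀ a : ℤ,
      ((Real.exp (Real.log x ^ ε) ≤ N ∧ N ≤ Q ^ (-(33 / 28 : ℝ)) * x ^ (17 / 28 - ε) ∧
          1 ≤ a.natAbs ∧ (a.natAbs : ℝ) ≤ x / 12) ∨
        (Real.exp (Real.log x ^ ε) ≤ N ∧ N ≤ x ^ (7 / 90 - ε) ∧ Q ≤ x ^ (45 / 89 - ε) ∧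
          1 ≤ a.natAbs ∧ (a.natAbs : ℝ) ≤ x / 12) ∨
        (Real.exp (Real.log x ^ ε) ≤ N ∧ N ≤ x ^ (101 / 630 - ε) ∧ Q ≤ x ^ (45 / 89 - ε) ∧
          1 ≤ a.natAbs ∧ (a.natAbs : ℝ) ≤ (x / 4) ^ (ε / 1000))) →
      (∑ q ∈ Icc 1 ⌊2 * Q⌋₊,
          if Q ≤ q ∧ IsCoprime (q : ℤ) a then ‖bilinEWindow α β M N x q a‖ else 0) ≤
        K * x / Real.log x ^ A

/-- **Wright 2026, Theorem 2.3** (arXiv:2604.25177 §2, p0005:L12–L28), as printed: "Let `k`, `ε`,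
`α_m`, and `β_n` be as in the previous corollary. Let `k ≥ 1` be an integer and let `ε > 0` be given.
[Suppose] `M > Q (MN)^ε`, `M > N > D^{10}`. Then, for all integers `1 ≤ |a| ≤ X/3`, we have
`|Δ(α,β,M,N,Q,a)| ≪ ‖α‖ ( M Q⁻¹ 𝓔*(β,N,Q) + (log X)^κ N² Q + (log X)^κ N² D^{−1/2} M`
`  + D^C X^ε ( Q^{15/8} N^{11/4} + M^{3/20} Q^{33/20} N^{51/20} ) )^{1/2}`.
In [FR], the last term is `D^C X^ε (Q^{15/8}N^{23/8} + M^{3/20}Q^{33/20}N^{59/20})`. Hence we have a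
savings of `N^{1/8}` in the first term and `N^{2/5}` in the second."  Here `X = MN`, `Δ` and `𝓔*` are
(1.5)/(1.6) of Fouvry–Radziwiłł (`FouvryRadziwill2022.Delta`, `.calEstar`), `κ = κ(k)`, `C = C(k,ε)`
as in [FR, Thm 1.1].  Rendered by the quantifier shape of `FouvryRadziwill2022.theorem11` (implicit
`0 < Q`, `1 ≤ D` as there), PLUS — because the print says "as in the previous corollary" — the
Siegel–Walfisz hypothesis on `β` (unused by the §4 proof before its last sentence; keeping it makes the
typed statement the printed, weaker one; constants may depend on its data).  Preprint (2026), named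
fact, not proved here. [cite: Wright2026TrilinearKloostermanI, §2 Theorem 2.3] -/
def Wright2026_theorem23 : Prop :=
  ∀ k : ℕ, 1 ≤ k → ∀ ε : ℝ, 0 < ε → ∀ (ksw : ℕ) (Csw : ℝ → ℝ), ∃ κ C K : ℝ, 0 < K ∧
    ∀ M N Q D : ℝ, 0 < Q → 1 ≤ D →
      Q * (M * N) ^ ε < M → N < M → D ^ (10 : ℕ) < N →
    ∀ α β : ℕ → ℂ, IsDivisorBounded k α → IsDivisorBounded k β →
      IsSiegelWalfiszWith ksw Csw β →
    ∀ a : ℤ, 1 ≤ a.natAbs → (a.natAbs : ℝ) ≤ M * N / 3 →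
      Delta α β M N Q a ≤
        K * l2Norm M α *
          Real.sqrt (M / Q * calEstar β N Q
            + Real.log (M * N) ^ κ * N ^ 2 * Q
            + Real.log (M * N) ^ κ * N ^ 2 * D ^ (-(1 / 2 : ℝ)) * M
            + D ^ C * (M * N) ^ ε *
                (Q ^ (15 / 8 : ℝ) * N ^ (11 / 4 : ℝ)
                  + M ^ (3 / 20 : ℝ) * Q ^ (33 / 20 : ℝ) * N ^ (51 / 20 : ℝ)))

/-- **Wright 2026, Corollary 2.4** (arXiv:2604.25177 §2, p0005:L32–L60), as printed: "Let `ε > 0` and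
`k > 0` be given. Let `λ_d` be a sequence of complex numbers with `|λ_d| ≤ τ_k(d)`. Then
`∑_{q∼Q, (q,a)=1} | ∑_{X<n≤2X, n≡a (q)} ∑_{d∣n, d≤z} λ_d − φ(q)⁻¹ ∑_{X<n≤2X, (n,q)=1} ∑_{d∣n, d≤z} λ_d | ≪_A X/(log X)^A`,
provided that one of the following three conditions holds:
(i) `X ≥ 12`, `z ≤ X^{45/89−ε}`, `X^{1−ε} > Q > X^{529/630+ε}`, and `1 ≤ |a| ≤ X^{ε/10000}`;
(ii) `X ≥ 12`, `z ≤ X^{45/89−ε}`, `X^{1−ε} > Q > X^{83/90+ε}`, and `1 ≤ |a| ≤ X^{1−3ε}`;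
(iii) `X ≥ 12`, `z ≤ X^{1/2+δ−ε}`, `X^{1−ε} > Q > X^{(55+66δ)/56+ε}`, and `1 ≤ |a| ≤ X^{1−3ε}` for any
fixed `0 < δ < 1/66`. In this case the implicit constant in `≪_A` depends additionally on `δ`."
("The proof … is essentially identical to that of Corollary 1.5 in [FR] … we omit this proof.")
(Improves `FouvryRadziwill2022.corollary15`: `53/105` ↦ `45/89`, `(71+66δ)/72` ↦ `(55+66δ)/56`.)
Rendered by the quantifier shape of `FouvryRadziwill2022.corollary15` (weight `∑_{d ∣ n, d ≤ z} λ_d`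
over `Nat.divisors n`; `K` may depend on `ε, k, δ, A`).  Preprint (2026), named fact, not proved here.
[cite: Wright2026TrilinearKloostermanI, §2 Corollary 2.4] -/
def Wright2026_corollary24 : Prop :=
  ∀ ε : ℝ, 0 < ε → ∀ k : ℕ, 0 < k → ∀ δ : ℝ, 0 < δ → δ < 1 / 66 → ∀ A : ℝ, 0 < A → ∃ K : ℝ,
    ∀ x z Q : ℝ, ∀ lam : ℕ → ℂ, IsDivisorBounded k lam → ∀ a : ℤ, 12 ≤ x →
      ((z ≤ x ^ (45 / 89 - ε) ∧ x ^ (529 / 630 + ε) < Q ∧ Q < x ^ (1 - ε) ∧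
          1 ≤ a.natAbs ∧ (a.natAbs : ℝ) ≤ x ^ (ε / 10000)) ∨
        (z ≤ x ^ (45 / 89 - ε) ∧ x ^ (83 / 90 + ε) < Q ∧ Q < x ^ (1 - ε) ∧
          1 ≤ a.natAbs ∧ (a.natAbs : ℝ) ≤ x ^ (1 - 3 * ε)) ∨
        (z ≤ x ^ (1 / 2 + δ - ε) ∧ x ^ ((55 + 66 * δ) / 56 + ε) < Q ∧ Q < x ^ (1 - ε) ∧
          1 ≤ a.natAbs ∧ (a.natAbs : ℝ) ≤ x ^ (1 - 3 * ε))) →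
      (∑ q ∈ BFI.dyadic Q,
          if IsCoprime (q : ℤ) a then
            ‖(∑ n ∈ BFI.dyadic x,
                if (n : ZMod q) = (a : ZMod q) then
                  ∑ d ∈ (Nat.divisors n).filter (fun d : ℕ => (d : ℝ) ≤ z), lam d else 0) -
              (∑ n ∈ BFI.dyadic x,
                if n.Coprime q then
                  ∑ d ∈ (Nat.divisors n).filter (fun d : ℕ => (d : ℝ) ≤ z), lam d else 0) /
                ((Nat.totient q : ℕ) : ℂ)‖
          else 0) ≤
        K * x / Real.log x ^ A

/-- Sanity (PROVED bookkeeping): the three `N`-ranges of Corollary 2.2 (ii)/(iii) and of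
Fouvry–Radziwiłł's Corollary 1.1 (ii)/(iii) coincide, and the new `Q`-exponent is the larger one:
`53/105 < 45/89` (so (ii)/(iii) of Corollary 2.2 contain (ii)/(iii) of [FR, Cor 1.1] as printed), while
in (i) `17/28 − 33/28·θ ≥ 17/36 − 11/12·θ` exactly for `θ ≤ 1/2 + 1/66 = 17/33` (`Q = x^θ`), with
equality at the common endpoint `θ = 17/33` ("the bound in (i) gives `Q ≤ X^{1/2+1/66−ε}`, which is the
same as in [FR]"). [cite: Wright2026TrilinearKloostermanI, §2 (remarks after Corollary 2.2)] -/
theorem Wright2026_corollary22_exponents :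
    (53 : ℝ) / 105 < 45 / 89 ∧
      (∀ θ : ℝ, θ ≤ 17 / 33 ↔ (17 : ℝ) / 36 - 11 / 12 * θ ≤ 17 / 28 - 33 / 28 * θ) ∧
      ((1 : ℝ) / 2 + 1 / 66 = 17 / 33) := by
  refine ⟨by norm_num, fun θ => ?_, by norm_num⟩
  constructor <;> intro h <;> linarith

end Dispersion

end Literature.NumberTheory.LFunctions

end
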